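import Literature.IUT.LogVolume.TameRadicalCoordinates
import Literature.IUT.LogVolume.TameQuadraticIsometryStable
import HarnessLib

/-!
# Isometries FIX the maximal order of the tame radical packet: `K = ℚ_p(π)`, `π^e = p`, `e ∣ p − 1`

Classical local algebra (nothing disputed; the [IUTchIV] locator records where the abc-iut cell uses it).
[IUTchIV] Prop. 1.1 p. 9 attaches to a tensor packet `V = ⊗_{ℚ_p} k_i` the lattice `R_I = ⊗_{ℤ_p} R_i` and its
normalisation `(R_I)^∼`, the MAXIMAL `ℤ_p`-order of `V` (campaign-S `normalizedPacket`; `ψ((R_I)^∼) = Π_j 𝒪_{L_j}` for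
the field-factor decomposition `ψ = dEquiv`).  abc-iut-E-t14's `TameQuadraticIsometryStable` is the case `e = 2`; THIS FILE is
the general TAME RADICAL packet of the first rung: `K` any ultrametric normed field over `ℚ_p`, `[K : ℚ_p] = e`, `π ∈ K`,
`π^e = p`, `e ∣ p − 1` (so `p ∤ e` and `μ_e ⊂ ℚ_p`), `V = K ⊗_{ℚ_p} K`.

* `exists_repr` — every `z ∈ K ⊗ K` is `Σ_{k<e} π^k ⊗ l_k`;
* `repr_mem_normalizedPacket` — **`Σ_k π^k ⊗ l_k ∈ (R_I)^∼` whenever every `‖π^k·l_k‖ ≤ 1`** (ANY `p`, ANY `e ≥ 1`: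
  `(π^k ⊗ l)^e = 1 ⊗ p^k·l^e ∈ R_I`, and `(R_I)^∼` is integrally closed over `R_I` by definition) — the «valuation box»,
  i.e. the unit ball of the ultrametric tensor-product norm, which strictly contains `R_I = 𝒪 ⊗ 𝒪` as soon as `e ≥ 2`;
* `exists_twist`, `exists_factor_of_twist` — in every field factor `L_j` of `ψ` the two images of `π` differ by an
  `e`-th root of unity `ζ^{m_j}`, `ζ ∈ ℚ_p` primitive, and EVERY twist `m < e` occurs at some factor (else the element
  `w_m = Σ_k ζ^{(e−m)k}·π^k ⊗ π^{e−k}` would have `ψ(w_m) = 0` although its `(π⁰)^* ⊗ (π⁰)^*`-coordinate is `p ≠ 0`);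
* **`mem_normalizedPacket_iff`** — for `e ∣ p − 1`: `(R_I)^∼ = {Σ_k π^k ⊗ l_k : ∀ k, ‖π^k·l_k‖ ≤ 1}` (`⊆`: the factor of
  twist `m` sees `ι_j(Σ_k ζ^{km}·π^k l_k)`, so all `e` twisted sums are integral, and discrete Fourier inversion over
  `μ_e(ℚ_p)` with `‖e‖ = 1` — the one place TAMENESS enters — returns `‖π^k l_k‖ ≤ 1`; part 1's `dft_inversion`);
* **`congr_repr_of_isometry`** — the box is mapped into itself by `σ ⊗ τ` for EVERY pair of `ℚ_p`-linear isometries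
  (`σ(π^i) = Σ_k a_{ik}π^k` with `‖a_{ik}‖·‖π‖^k ≤ ‖π‖^i`, part 1's `isometry_coeff_bound`; any `p`, `e ≥ 1`);
* **`congr_mem_normalizedPacket_of_isometry`**, **`congr_image_normalizedPacket_eq_of_isometry`**,
  **`not_exists_isometry_mover`** — for `e ∣ p − 1` every factorwise isometry maps `(R_I)^∼` ONTO itself: NO pair
  (isometries `f`, `z ∈ (R_I)^∼`) with `(⊗ f_i)(z) ∉ (R_I)^∼` exists — the negation, at every tame radical packet of the first
  rung, of the exhibit shape `hmove` of the abc-iut cell's Y-29b reduction `Joshi/TestRealPinsMaxOrderMover`, against the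
  wild movers of `WildCubicIsometryMover` (`ℚ₃(∛3)`) / `WildQuadraticIsometryMover` (`ℚ₂(√2)`);
* **`exists_tameRadical_isometry_stable`** — NON-VACUITY inside `ℚ̄_p` for every prime `p` and every `e ∣ p − 1`
  (`E = ℚ_p(p^{1/e})`).

Use (abc-iut cell, R-J row Y-29b «sign by place type», E-t42's dividing line «isometry-stable ⟺ ⊗-norm saturated ⟺ tame»
on the positive side): CONTAINERS only; S-IDLE on print-shaped data; no side is taken on [IUTchIII] Cor. 3.12.
Proof-only file (theorems, no definitions).
[cite: Mochizuki2012, IUTchIV Prop. 1.1 p. 9, Prop. 1.4 (i) p. 13] [cite: NeukirchANT1999, Ch. II (5.5)]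
[cite: Gouvea1993PadicNumbers, Prop. 4.6.1 (§4.6)]
-/

noncomputable section

open Metric Set
open scoped TensorProduct

namespace Literature.IUT.LogVolume

namespace TameRadical

variable {p : ℕ} [Fact p.Prime]
variable {K : Type} [NontriviallyNormedField K] [NormedAlgebra ℚ_[p] K] {π : K} {e : ℕ}

/-! ## Pure tensors of the two-factor packet `K ⊗_{ℚ_p} K` (sums in a slot, the coordinate functional) -/

/-- Finite sums in the left slot: `(Σ_i x_i) ⊗ y = Σ_i x_i ⊗ y`. [cite: Mochizuki2012, IUTchIV Prop. 1.1 p. 9] -/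
theorem purePacket_pair_sum_left (p : ℕ) [Fact p.Prime] [NormedAlgebra ℚ_[p] K] {ι : Type*} (s : Finset ι)
    (x : ι → K) (y : K) :
    purePacket p (fun _ : Fin 2 => K) ![∑ i ∈ s, x i, y] = ∑ i ∈ s, purePacket p (fun _ : Fin 2 => K) ![x i, y] := by
  rw [TameQuadratic.purePacket_pair_eq_iota_mul p, map_sum, Finset.sum_mul]
  exact Finset.sum_congr rfl fun i _ => by rw [TameQuadratic.purePacket_pair_eq_iota_mul p]

/-- Finite sums in the right slot: `x ⊗ (Σ_i y_i) = Σ_i x ⊗ y_i`. [cite: Mochizuki2012, IUTchIV Prop. 1.1 p. 9] -/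
theorem purePacket_pair_sum_right (p : ℕ) [Fact p.Prime] [NormedAlgebra ℚ_[p] K] {ι : Type*} (s : Finset ι)
    (x : K) (y : ι → K) :
    purePacket p (fun _ : Fin 2 => K) ![x, ∑ i ∈ s, y i] = ∑ i ∈ s, purePacket p (fun _ : Fin 2 => K) ![x, y i] := by
  rw [TameQuadratic.purePacket_pair_eq_iota_mul p, map_sum, Finset.mul_sum]
  exact Finset.sum_congr rfl fun i _ => by rw [TameQuadratic.purePacket_pair_eq_iota_mul p]

/-- A rational power on the left moves to the right slot: `p^k ⊗ y = 1 ⊗ p^k·y`. [cite: Mochizuki2012, IUTchIV Prop. 1.1 p. 9] -/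
theorem purePacket_pair_natCast_pow_left (p : ℕ) [Fact p.Prime] [NormedAlgebra ℚ_[p] K] (n k : ℕ) (y : K) :
    purePacket p (fun _ : Fin 2 => K) ![(n : K) ^ k, y] = purePacket p (fun _ : Fin 2 => K) ![1, (n : K) ^ k * y] := by
  rw [TameQuadratic.purePacket_pair_eq_iota_mul p, TameQuadratic.purePacket_pair_eq_iota_mul p, map_one, one_mul,
    map_mul, map_pow, map_pow, map_natCast, map_natCast]

/-- The functional `φ ⊗ ψ` on pure tensors: `(φ ⊗ ψ)(x ⊗ y) = φ(x)·ψ(y)`. [cite: Mochizuki2012, IUTchIV Prop. 1.1 p. 9] -/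
theorem lift_pair_purePacket (φ ψ : K →ₗ[ℚ_[p]] ℚ_[p]) (x y : K) :
    PiTensorProduct.lift ((MultilinearMap.mkPiAlgebra ℚ_[p] (Fin 2) ℚ_[p]).compLinearMap
        (![φ, ψ] : ∀ _ : Fin 2, K →ₗ[ℚ_[p]] ℚ_[p]))
      (purePacket p (fun _ : Fin 2 => K) ![x, y]) = φ x * ψ y := by
  rw [purePacket, PiTensorProduct.lift.tprod, MultilinearMap.compLinearMap_apply, MultilinearMap.mkPiAlgebra_apply,
    Fin.prod_univ_two]
  rfl

/-- **Every `z ∈ K ⊗_{ℚ_p} K` is `Σ_{k<e} π^k ⊗ l_k`** (expand the left slot in the basis `(π^k)` and move the coordinates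
to the right slot). [cite: Mochizuki2012, IUTchIV Prop. 1.1 p. 9] -/
theorem exists_repr (B : Module.Basis (Fin e) ℚ_[p] K) (hB : ∀ k, B k = π ^ (k : ℕ))
    (z : PacketAlgebra p (fun _ : Fin 2 => K)) :
    ∃ l : Fin e → K, z = ∑ k : Fin e, purePacket p (fun _ : Fin 2 => K) ![π ^ (k : ℕ), l k] := by
  induction z using PiTensorProduct.induction_on with
  | smul_tprod r f =>
    have hf : PiTensorProduct.tprod ℚ_[p] f = purePacket p (fun _ : Fin 2 => K) ![f 0, f 1] := by
      rw [purePacket]; congr 1; funext i; fin_cases i <;> rfl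
    refine ⟨fun k => r • (B.repr (f 0) k • f 1), ?_⟩
    rw [hf]
    conv_lhs => rw [← sum_repr B hB (f 0)]
    rw [purePacket_pair_sum_left p, Finset.smul_sum]
    refine Finset.sum_congr rfl fun k _ => ?_
    rw [TameQuadratic.purePacket_pair_smul_left, ← TameQuadratic.purePacket_pair_smul_left' r,
      TameQuadratic.purePacket_pair_smul_left]
  | add x y hx hy =>
    obtain ⟨l, rfl⟩ := hx
    obtain ⟨m, rfl⟩ := hy
    refine ⟨l + m, ?_⟩
    rw [← Finset.sum_add_distrib]
    exact Finset.sum_congr rfl fun k _ => by rw [Pi.add_apply, TameQuadratic.purePacket_pair_add_right p]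

/-! ## The valuation box lies in `(R_I)^∼` (any `p`, any `e ≥ 1`) -/

/-- **`Σ_k π^k ⊗ l_k ∈ (R_I)^∼` whenever every `‖π^k·l_k‖ ≤ 1`**: the `e`-th power of `π^k ⊗ l` is `1 ⊗ p^k·l^e ∈ R_I`
(`‖p^k·l^e‖ = ‖π^k·l‖^e ≤ 1`), and `(R_I)^∼` is integrally closed over `R_I`. [cite: Mochizuki2012, IUTchIV Prop. 1.1 p. 9] -/
theorem repr_mem_normalizedPacket (he : 0 < e) (hπ : π ^ e = (p : K)) {l : Fin e → K}
    (hl : ∀ k : Fin e, ‖π ^ (k : ℕ) * l k‖ ≤ 1) :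
    ∑ k : Fin e, purePacket p (fun _ : Fin 2 => K) ![π ^ (k : ℕ), l k] ∈ normalizedPacket p (fun _ : Fin 2 => K) := by
  refine Subring.sum_mem _ fun k _ => mem_normalizedPacket_of_pow_mem p _ he ?_
  have hpow : purePacket p (fun _ : Fin 2 => K) ![π ^ (k : ℕ), l k] ^ e =
      purePacket p (fun _ : Fin 2 => K) ![1, (p : K) ^ (k : ℕ) * l k ^ e] := by
    rw [purePacket_pow]
    have h1 : (![π ^ (k : ℕ), l k] : Fin 2 → K) ^ e = ![(p : K) ^ (k : ℕ), l k ^ e] := by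
      funext i; fin_cases i
      · show (π ^ (k : ℕ)) ^ e = (p : K) ^ (k : ℕ)
        rw [← pow_mul, mul_comm, pow_mul, hπ]
      · rfl
    rw [h1, purePacket_pair_natCast_pow_left p]
  rw [hpow]
  refine purePacket_mem_integerPacket p _ fun i => ?_
  fin_cases i
  · show ‖(1 : K)‖ ≤ 1
    rw [norm_one]
  · show ‖(p : K) ^ (k : ℕ) * l k ^ e‖ ≤ 1
    have h2 : ‖(p : K) ^ (k : ℕ) * l k ^ e‖ = ‖π ^ (k : ℕ) * l k‖ ^ e := by
      rw [norm_mul, norm_pow, norm_pow, norm_mul, norm_pow, mul_pow, ← pow_mul, mul_comm (k : ℕ) e, pow_mul,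
        norm_pi_pow_e hπ, TameQuadratic.norm_p p]
    rw [h2]
    exact pow_le_one₀ (norm_nonneg _) (hl k)

/-! ## The field factors of `K ⊗_{ℚ_p} K`: twists by `e`-th roots of unity -/

section Factors

variable [IsUltrametricDist K] [ProperSpace K]

omit [IsUltrametricDist K] in
/-- In every field factor `L_j`, the `e`-th power of either image of `π` is `p`. [cite: Mochizuki2012, IUTchIV Prop. 1.4 (i) p. 13] -/
theorem dEquiv_iota_pi_pow_e (hπ : π ^ e = (p : K)) (i : Fin 2) (j : DIdx p (fun _ : Fin 2 => K)) :
    dEquiv p (fun _ : Fin 2 => K) (iota p (fun _ : Fin 2 => K) i π) j ^ e = (p : DFac p (fun _ : Fin 2 => K) j) := by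
  rw [← Pi.pow_apply, ← map_pow, ← map_pow, hπ, map_natCast, map_natCast, Pi.natCast_apply]

omit [IsUltrametricDist K] in
/-- `ψ(ι_i(x^n))_j = ψ(ι_i(x))_j^n`. [cite: Mochizuki2012, IUTchIV Prop. 1.4 (i) p. 13] -/
theorem dEquiv_iota_pow (i : Fin 2) (x : K) (n : ℕ) (j : DIdx p (fun _ : Fin 2 => K)) :
    dEquiv p (fun _ : Fin 2 => K) (iota p (fun _ : Fin 2 => K) i (x ^ n)) j =
      dEquiv p (fun _ : Fin 2 => K) (iota p (fun _ : Fin 2 => K) i x) j ^ n := by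
  rw [map_pow, map_pow, Pi.pow_apply]

omit [IsUltrametricDist K] in
/-- `ψ(ι_i(c·x))_j = c·ψ(ι_i(x))_j` for `c ∈ ℚ_p`. [cite: Mochizuki2012, IUTchIV Prop. 1.4 (i) p. 13] -/
theorem dEquiv_iota_smul (i : Fin 2) (c : ℚ_[p]) (x : K) (j : DIdx p (fun _ : Fin 2 => K)) :
    dEquiv p (fun _ : Fin 2 => K) (iota p (fun _ : Fin 2 => K) i (c • x)) j =
      algebraMap ℚ_[p] (DFac p (fun _ : Fin 2 => K) j) c * dEquiv p (fun _ : Fin 2 => K) (iota p (fun _ : Fin 2 => K) i x) j := by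
  rw [map_smul, map_smul, Pi.smul_apply, Algebra.smul_def]

omit [IsUltrametricDist K] in
/-- **The two images of `π` in a field factor differ by an `e`-th root of unity of `ℚ_p`** (`e ∣ p − 1`, `ζ ∈ ℚ_p` primitive:
`(α_j/β_j)^e = p/p = 1`, and the `e`-th roots of unity of the field `L_j` are the powers of `ζ`). [cite: Mochizuki2012, IUTchIV Prop. 1.4 (i) p. 13] -/
theorem exists_twist (hep : e ∣ p - 1) (hπ : π ^ e = (p : K)) {ζ : ℚ_[p]} (hζ : IsPrimitiveRoot ζ e)
    (j : DIdx p (fun _ : Fin 2 => K)) :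
    ∃ m : Fin e, dEquiv p (fun _ : Fin 2 => K) (iota p (fun _ : Fin 2 => K) 0 π) j =
      algebraMap ℚ_[p] (DFac p (fun _ : Fin 2 => K) j) (ζ ^ (m : ℕ)) *
        dEquiv p (fun _ : Fin 2 => K) (iota p (fun _ : Fin 2 => K) 1 π) j := by
  have he := pos_of_dvd_sub_one hep
  set a := dEquiv p (fun _ : Fin 2 => K) (iota p (fun _ : Fin 2 => K) 0 π) j with ha_def
  set b := dEquiv p (fun _ : Fin 2 => K) (iota p (fun _ : Fin 2 => K) 1 π) j with hb_def
  have hb : b ≠ 0 := dEquiv_iota_ne_zero p (fun _ : Fin 2 => K) 1 (pi_ne_zero he hπ) j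
  have hae : a ^ e = (p : DFac p (fun _ : Fin 2 => K) j) := dEquiv_iota_pi_pow_e hπ 0 j
  have hbe : b ^ e = (p : DFac p (fun _ : Fin 2 => K) j) := dEquiv_iota_pi_pow_e hπ 1 j
  have hp0 : (p : DFac p (fun _ : Fin 2 => K) j) ≠ 0 := by
    rw [← norm_pos_iff, TameQuadratic.norm_p p]
    have : (0 : ℝ) < p := by exact_mod_cast (Fact.out : p.Prime).pos
    positivity
  have hξ : (a * b⁻¹) ^ e = 1 := by
    rw [mul_pow, inv_pow, hae, hbe, mul_inv_cancel₀ hp0]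
  have hζ' : IsPrimitiveRoot (algebraMap ℚ_[p] (DFac p (fun _ : Fin 2 => K) j) ζ) e :=
    hζ.map_of_injective (algebraMap ℚ_[p] (DFac p (fun _ : Fin 2 => K) j)).injective
  haveI : NeZero e := ⟨he.ne'⟩
  obtain ⟨m, hm, hmeq⟩ := hζ'.eq_pow_of_pow_eq_one hξ
  refine ⟨⟨m, hm⟩, ?_⟩
  rw [map_pow, hmeq, inv_mul_cancel_right₀ hb]

omit [IsUltrametricDist K] in
/-- **Field-factor coordinates of `Σ_k π^k ⊗ l_k` at a factor of twist `m`**: `ψ(Σ_k π^k ⊗ l_k)_j = ψ(ι₁(Σ_k ζ^{km}·π^k l_k))_j`.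
[cite: Mochizuki2012, IUTchIV Prop. 1.4 (i) p. 13] -/
theorem dEquiv_sum_repr {ζ : ℚ_[p]} {j : DIdx p (fun _ : Fin 2 => K)} {m : Fin e}
    (hm : dEquiv p (fun _ : Fin 2 => K) (iota p (fun _ : Fin 2 => K) 0 π) j =
      algebraMap ℚ_[p] (DFac p (fun _ : Fin 2 => K) j) (ζ ^ (m : ℕ)) *
        dEquiv p (fun _ : Fin 2 => K) (iota p (fun _ : Fin 2 => K) 1 π) j)
    (l : Fin e → K) :
    dEquiv p (fun _ : Fin 2 => K) (∑ k : Fin e, purePacket p (fun _ : Fin 2 => K) ![π ^ (k : ℕ), l k]) j =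
      dEquiv p (fun _ : Fin 2 => K) (iota p (fun _ : Fin 2 => K) 1
        (∑ k : Fin e, ζ ^ ((k : ℕ) * (m : ℕ)) • (π ^ (k : ℕ) * l k))) j := by
  rw [map_sum, map_sum, map_sum, Finset.sum_apply, Finset.sum_apply]
  refine Finset.sum_congr rfl fun k _ => ?_
  rw [TameQuadratic.dEquiv_purePacket_pair, dEquiv_iota_pow, hm, mul_pow, ← map_pow, ← pow_mul, mul_comm (m : ℕ),
    dEquiv_iota_smul, map_mul (iota p (fun _ : Fin 2 => K) 1), map_mul (dEquiv p (fun _ : Fin 2 => K)), Pi.mul_apply,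
    dEquiv_iota_pow, mul_assoc]

/-- **EVERY twist `m < e` occurs at some field factor.** Otherwise `w_m := Σ_{k<e} ζ^{(e−m)k}·π^k ⊗ π^{e−k}` has
`ψ(w_m)_j = p·Σ_k ζ^{(e−m+m_j)k} = 0` at every factor (character orthogonality, `m_j ≠ m`), so `w_m = 0`; but its
`(π⁰)^* ⊗ (π⁰)^*`-coordinate is `p ≠ 0`. [cite: Mochizuki2012, IUTchIV Prop. 1.4 (i) p. 13] -/
theorem exists_factor_of_twist (hep : e ∣ p - 1) (hK : Module.finrank ℚ_[p] K = e) (hπ : π ^ e = (p : K)) {ζ : ℚ_[p]}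
    (hζ : IsPrimitiveRoot ζ e) (m : Fin e) :
    ∃ j : DIdx p (fun _ : Fin 2 => K), dEquiv p (fun _ : Fin 2 => K) (iota p (fun _ : Fin 2 => K) 0 π) j =
      algebraMap ℚ_[p] (DFac p (fun _ : Fin 2 => K) j) (ζ ^ (m : ℕ)) *
        dEquiv p (fun _ : Fin 2 => K) (iota p (fun _ : Fin 2 => K) 1 π) j := by
  have he := pos_of_dvd_sub_one hep
  obtain ⟨B, hB⟩ := exists_basis he hK hπ
  by_contra hcon
  push Not at hcon
  -- the test element `w_m`
  set w : PacketAlgebra p (fun _ : Fin 2 => K) :=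
    ∑ k : Fin e, ζ ^ ((e - m) * (k : ℕ)) • purePacket p (fun _ : Fin 2 => K) ![π ^ (k : ℕ), π ^ (e - (k : ℕ))] with hw_def
  -- `ψ(w) = 0`
  have hψ : dEquiv p (fun _ : Fin 2 => K) w = 0 := by
    funext j
    obtain ⟨mj, hmj⟩ := exists_twist hep hπ hζ j
    have hne : mj ≠ m := fun h => hcon j (h ▸ hmj)
    set b := dEquiv p (fun _ : Fin 2 => K) (iota p (fun _ : Fin 2 => K) 1 π) j with hb_def
    have hbe : b ^ e = (p : DFac p (fun _ : Fin 2 => K) j) := dEquiv_iota_pi_pow_e hπ 1 j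
    have hterm : ∀ k : Fin e, dEquiv p (fun _ : Fin 2 => K)
        (ζ ^ ((e - m) * (k : ℕ)) • purePacket p (fun _ : Fin 2 => K) ![π ^ (k : ℕ), π ^ (e - (k : ℕ))]) j =
        algebraMap ℚ_[p] (DFac p (fun _ : Fin 2 => K) j) (ζ ^ ((e - m + mj) * (k : ℕ))) * (p : DFac p (fun _ : Fin 2 => K) j) := by
      intro k
      rw [map_smul, Pi.smul_apply, TameQuadratic.dEquiv_purePacket_pair, dEquiv_iota_pow, dEquiv_iota_pow, hmj, ← hb_def,
        mul_pow, ← map_pow, ← pow_mul, mul_assoc, ← pow_add, Nat.add_sub_cancel' k.2.le, hbe, Algebra.smul_def,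
        ← mul_assoc, ← map_mul, ← pow_add, add_mul]
    rw [Pi.zero_apply, hw_def, map_sum, Finset.sum_apply, Finset.sum_congr rfl fun k _ => hterm k, ← Finset.sum_mul,
      ← map_sum, sum_pow_mul_eq hζ m mj, if_neg hne, map_zero, zero_mul]
  have hw0 : w = 0 := (dEquiv p (fun _ : Fin 2 => K)).injective (by rw [hψ, map_zero])
  -- but the `(π⁰)^* ⊗ (π⁰)^*`-coordinate of `w` is `p`
  have h0e : ((⟨0, he⟩ : Fin e) : ℕ) = 0 := rfl
  have hcoord : ∀ k : Fin e, B.repr (π ^ (k : ℕ)) ⟨0, he⟩ = if k = ⟨0, he⟩ then 1 else 0 := fun k => repr_pi_pow B hB k _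
  have hpe : π ^ (e - 0) = (p : ℚ_[p]) • π ^ ((⟨0, he⟩ : Fin e) : ℕ) := by
    rw [Nat.sub_zero, hπ, h0e, pow_zero, ← map_natCast (algebraMap ℚ_[p] K) p, Algebra.algebraMap_eq_smul_one]
  have hΦ := congrArg (PiTensorProduct.lift ((MultilinearMap.mkPiAlgebra ℚ_[p] (Fin 2) ℚ_[p]).compLinearMap
      (![B.coord ⟨0, he⟩, B.coord ⟨0, he⟩] : ∀ _ : Fin 2, K →ₗ[ℚ_[p]] ℚ_[p]))) hw0
  rw [map_zero, hw_def, map_sum, Finset.sum_eq_single (⟨0, he⟩ : Fin e)] at hΦ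
  · rw [map_smul, lift_pair_purePacket, Module.Basis.coord_apply, Module.Basis.coord_apply, hcoord, if_pos rfl, h0e,
      mul_zero, pow_zero, one_smul, one_mul, hpe, map_smul, Finsupp.smul_apply, hcoord, if_pos rfl, smul_eq_mul,
      mul_one] at hΦ
    exact (Nat.cast_ne_zero.mpr (Fact.out : p.Prime).ne_zero) hΦ
  · intro k _ hk
    rw [map_smul, lift_pair_purePacket, Module.Basis.coord_apply, hcoord, if_neg hk, zero_mul, smul_zero]
  · intro h; exact absurd (Finset.mem_univ _) h

/-- **For `e ∣ p − 1`, every `z = Σ_k π^k ⊗ l_k ∈ (R_I)^∼` has all `‖π^k·l_k‖ ≤ 1`**: the factor of twist `m` sees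
`ι_j(Σ_k ζ^{km}·π^k l_k)`, which is integral; discrete Fourier inversion (`‖e‖ = ‖ζ‖ = 1`). [cite: Mochizuki2012, IUTchIV Prop. 1.1 p. 9] -/
theorem norm_repr_le_of_mem_normalizedPacket (hep : e ∣ p - 1) (hK : Module.finrank ℚ_[p] K = e) (hπ : π ^ e = (p : K))
    {l : Fin e → K}
    (hz : ∑ k : Fin e, purePacket p (fun _ : Fin 2 => K) ![π ^ (k : ℕ), l k] ∈ normalizedPacket p (fun _ : Fin 2 => K))
    (i : Fin e) : ‖π ^ (i : ℕ) * l i‖ ≤ 1 := by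
  obtain ⟨ζ, hζ⟩ := exists_isPrimitiveRoot (p := p) hep
  refine norm_le_one_of_forall_norm_twisted_sum_le hep hζ (fun k => π ^ (k : ℕ) * l k) (fun m => ?_) i
  obtain ⟨j, hj⟩ := exists_factor_of_twist hep hK hπ hζ m
  have h := norm_dEquiv_le_one_of_mem_normalizedPacket p (fun _ : Fin 2 => K) hz j
  rwa [dEquiv_sum_repr hj, norm_dEquiv_iota] at h

/-- **THE MAXIMAL ORDER OF THE TAME RADICAL PACKET** (`e ∣ p − 1`, `[K : ℚ_p] = e`, `π^e = p`):
`(R_I)^∼ = {Σ_{k<e} π^k ⊗ l_k : ∀ k, ‖π^k·l_k‖ ≤ 1}` — the unit ball of the ultrametric tensor-product norm, strictly larger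
than `R_I = 𝒪_K ⊗ 𝒪_K` for `e ≥ 2`. [cite: Mochizuki2012, IUTchIV Prop. 1.1 p. 9] [cite: NeukirchANT1999, Ch. II (5.5)] -/
theorem mem_normalizedPacket_iff (hep : e ∣ p - 1) (hK : Module.finrank ℚ_[p] K = e) (hπ : π ^ e = (p : K))
    (z : PacketAlgebra p (fun _ : Fin 2 => K)) :
    z ∈ normalizedPacket p (fun _ : Fin 2 => K) ↔
      ∃ l : Fin e → K, (∀ k : Fin e, ‖π ^ (k : ℕ) * l k‖ ≤ 1) ∧
        z = ∑ k : Fin e, purePacket p (fun _ : Fin 2 => K) ![π ^ (k : ℕ), l k] := by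
  have he := pos_of_dvd_sub_one hep
  constructor
  · intro hz
    obtain ⟨B, hB⟩ := exists_basis he hK hπ
    obtain ⟨l, rfl⟩ := exists_repr B hB z
    exact ⟨l, norm_repr_le_of_mem_normalizedPacket hep hK hπ hz, rfl⟩
  · rintro ⟨l, hl, rfl⟩
    exact repr_mem_normalizedPacket he hπ hl

end Factors

/-! ## Factorwise isometries -/

/-- **`σ ⊗ τ` preserves the valuation box** for every pair of `ℚ_p`-linear ISOMETRIES `σ = f 0`, `τ = f 1` of `K` (any `p`,
`e ≥ 1`, `[K : ℚ_p] = e`): with `σ(π^i) = Σ_k a_{ik}·π^k` the image of `Σ_i π^i ⊗ l_i` is `Σ_k π^k ⊗ (Σ_i a_{ik}·τ l_i)`, and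
`‖π‖^k·‖a_{ik}‖·‖l_i‖ ≤ ‖π‖^i·‖l_i‖ ≤ 1`. [cite: NeukirchANT1999, Ch. II (5.5)] [cite: Mochizuki2012, IUTchIV Prop. 1.1 p. 9] -/
theorem congr_repr_of_isometry [IsUltrametricDist K] (he : 0 < e) (hK : Module.finrank ℚ_[p] K = e)
    (hπ : π ^ e = (p : K)) (f : ∀ _ : Fin 2, K ≃ₗ[ℚ_[p]] K) (hf : ∀ i x, ‖f i x‖ = ‖x‖) {l : Fin e → K}
    (hl : ∀ k : Fin e, ‖π ^ (k : ℕ) * l k‖ ≤ 1) :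
    ∃ m : Fin e → K, (∀ k : Fin e, ‖π ^ (k : ℕ) * m k‖ ≤ 1) ∧
      (PiTensorProduct.congr f :
          PacketAlgebra p (fun _ : Fin 2 => K) ≃ₗ[ℚ_[p]] PacketAlgebra p (fun _ : Fin 2 => K))
          (∑ k : Fin e, purePacket p (fun _ : Fin 2 => K) ![π ^ (k : ℕ), l k]) =
        ∑ k : Fin e, purePacket p (fun _ : Fin 2 => K) ![π ^ (k : ℕ), m k] := by
  obtain ⟨B, hB⟩ := exists_basis he hK hπ
  refine ⟨fun k : Fin e => ∑ i : Fin e, B.repr (f 0 (π ^ (i : ℕ))) k • f 1 (l i), fun k => ?_, ?_⟩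
  · rw [Finset.mul_sum]
    refine IsUltrametricDist.norm_sum_le_of_forall_le_of_nonneg zero_le_one fun i _ => ?_
    rw [mul_smul_comm, norm_smul, norm_mul, norm_pow, hf, ← norm_pow, ← norm_mul]
    calc ‖B.repr (f 0 (π ^ (i : ℕ))) k‖ * ‖π ^ (k : ℕ) * l i‖
        = ‖B.repr (f 0 (π ^ (i : ℕ))) k‖ * ‖π‖ ^ (k : ℕ) * ‖l i‖ := by rw [norm_mul, norm_pow, mul_assoc]
      _ ≤ ‖π‖ ^ (i : ℕ) * ‖l i‖ := mul_le_mul_of_nonneg_right (isometry_coeff_bound B hπ hB (f 0) (hf 0) i k) (norm_nonneg _)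
      _ = ‖π ^ (i : ℕ) * l i‖ := by rw [norm_mul, norm_pow]
      _ ≤ 1 := hl i
  · rw [map_sum]
    have h1 : ∀ i : Fin e, (PiTensorProduct.congr f :
          PacketAlgebra p (fun _ : Fin 2 => K) ≃ₗ[ℚ_[p]] PacketAlgebra p (fun _ : Fin 2 => K))
          (purePacket p (fun _ : Fin 2 => K) ![π ^ (i : ℕ), l i]) =
        ∑ k : Fin e, purePacket p (fun _ : Fin 2 => K) ![π ^ (k : ℕ), B.repr (f 0 (π ^ (i : ℕ))) k • f 1 (l i)] := by
      intro i
      rw [TameQuadratic.congr_purePacket_pair]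
      conv_lhs => rw [← sum_repr B hB (f 0 (π ^ (i : ℕ)))]
      rw [purePacket_pair_sum_left p]
      exact Finset.sum_congr rfl fun k _ => by rw [TameQuadratic.purePacket_pair_smul_left]
    rw [Finset.sum_congr rfl fun i _ => h1 i, Finset.sum_comm]
    exact Finset.sum_congr rfl fun k _ => by rw [purePacket_pair_sum_right p]

variable [IsUltrametricDist K] [ProperSpace K]

/-- **ISOMETRIES FIX THE MAXIMAL ORDER OF THE TAME RADICAL PACKET.**  `e ∣ p − 1`, `[K : ℚ_p] = e`, `π^e = p`: for every pair
of `ℚ_p`-linear isometries `f₀, f₁` of `K` and every `z ∈ (R_I)^∼`, `(f₀ ⊗ f₁)(z) ∈ (R_I)^∼`.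
[cite: Mochizuki2012, IUTchIV Prop. 1.1 p. 9] [cite: NeukirchANT1999, Ch. II (5.5)] -/
theorem congr_mem_normalizedPacket_of_isometry (hep : e ∣ p - 1) (hK : Module.finrank ℚ_[p] K = e)
    (hπ : π ^ e = (p : K)) (f : ∀ _ : Fin 2, K ≃ₗ[ℚ_[p]] K) (hf : ∀ i x, ‖f i x‖ = ‖x‖)
    {z : PacketAlgebra p (fun _ : Fin 2 => K)} (hz : z ∈ normalizedPacket p (fun _ : Fin 2 => K)) :
    (PiTensorProduct.congr f :
        PacketAlgebra p (fun _ : Fin 2 => K) ≃ₗ[ℚ_[p]] PacketAlgebra p (fun _ : Fin 2 => K)) z ∈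
      normalizedPacket p (fun _ : Fin 2 => K) := by
  have he := pos_of_dvd_sub_one hep
  obtain ⟨l, hl, rfl⟩ := (mem_normalizedPacket_iff hep hK hπ z).mp hz
  obtain ⟨m, hm, hmeq⟩ := congr_repr_of_isometry he hK hπ f hf hl
  rw [hmeq]
  exact repr_mem_normalizedPacket he hπ hm

/-- **… and ONTO itself: `(f₀ ⊗ f₁)((R_I)^∼) = (R_I)^∼`** (apply the previous statement to `f` and to `f⁻¹`).
[cite: Mochizuki2012, IUTchIV Prop. 1.1 p. 9] [cite: NeukirchANT1999, Ch. II (5.5)] -/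
theorem congr_image_normalizedPacket_eq_of_isometry (hep : e ∣ p - 1) (hK : Module.finrank ℚ_[p] K = e)
    (hπ : π ^ e = (p : K)) (f : ∀ _ : Fin 2, K ≃ₗ[ℚ_[p]] K) (hf : ∀ i x, ‖f i x‖ = ‖x‖) :
    (PiTensorProduct.congr f :
        PacketAlgebra p (fun _ : Fin 2 => K) ≃ₗ[ℚ_[p]] PacketAlgebra p (fun _ : Fin 2 => K)) ''
        (normalizedPacket p (fun _ : Fin 2 => K) : Set (PacketAlgebra p (fun _ : Fin 2 => K))) =
      (normalizedPacket p (fun _ : Fin 2 => K) : Set (PacketAlgebra p (fun _ : Fin 2 => K))) := by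
  have hf' : ∀ i x, ‖(f i).symm x‖ = ‖x‖ := fun i x => by
    conv_rhs => rw [← (f i).apply_symm_apply x]
    rw [hf]
  apply Set.Subset.antisymm
  · rintro _ ⟨z, hz, rfl⟩
    exact congr_mem_normalizedPacket_of_isometry hep hK hπ f hf hz
  · intro w hw
    exact ⟨_, congr_mem_normalizedPacket_of_isometry hep hK hπ (fun i => (f i).symm) hf' hw,
      TameQuadratic.congr_congr_symm_apply f w⟩

/-- **NO ISOMETRIC MAXIMAL-ORDER MOVER EXISTS AT A TAME RADICAL PACKET** (`e ∣ p − 1`): there is no pair (factorwise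
`ℚ_p`-linear isometries `f`, point `z ∈ (R_I)^∼`) with `(⊗ f_i)(z) ∉ (R_I)^∼` — the negation of the exhibit shape `hmove` of
`Joshi/TestRealPinsMaxOrderMover`, against the wild movers of `WildCubicIsometryMover` / `WildQuadraticIsometryMover`.
[cite: Mochizuki2012, IUTchIV Prop. 1.1 p. 9] -/
theorem not_exists_isometry_mover (hep : e ∣ p - 1) (hK : Module.finrank ℚ_[p] K = e) (hπ : π ^ e = (p : K)) :
    ¬ ∃ (f : ∀ _ : Fin 2, K ≃ₗ[ℚ_[p]] K) (_ : ∀ i x, ‖f i x‖ = ‖x‖) (z : PacketAlgebra p (fun _ : Fin 2 => K)),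
      z ∈ (normalizedPacket p (fun _ : Fin 2 => K) : Set (PacketAlgebra p (fun _ : Fin 2 => K))) ∧
        (PiTensorProduct.congr f :
            PacketAlgebra p (fun _ : Fin 2 => K) ≃ₗ[ℚ_[p]] PacketAlgebra p (fun _ : Fin 2 => K)) z ∉
          (normalizedPacket p (fun _ : Fin 2 => K) : Set (PacketAlgebra p (fun _ : Fin 2 => K))) := by
  rintro ⟨f, hf, z, hz, hnot⟩
  exact hnot (congr_mem_normalizedPacket_of_isometry hep hK hπ f hf hz)

end TameRadical

/-! ## Non-vacuity: `ℚ_p(p^{1/e}) ⊆ ℚ̄_p`, `e ∣ p − 1` -/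

/-- **NON-VACUITY: AT `ℚ_p(p^{1/e})`, `e ∣ p − 1`, FACTORWISE ISOMETRIES FIX THE MAXIMAL ORDER.**  For every prime `p` and every
`e ∣ p − 1` there is a finite `E ⊆ ℚ̄_p` with `[E : ℚ_p] = e` (namely `E = ℚ_p(p^{1/e})`, totally and TAMELY ramified of index `e`,
`(R_I)^∼ ⊋ R_I` once `e ≥ 2`) such that for ALL `ℚ_p`-linear isometries `f₀, f₁` of `E` (each maps `𝒪_E` and every `𝔪_E^n` onto
itself) one has `(f₀ ⊗ f₁)((R_I)^∼) = (R_I)^∼` in `E ⊗_{ℚ_p} E` — contrast `exists_wildCubic_isometry_maxOrder_mover` and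
`exists_wildQuadratic_isometry_maxOrder_mover`. [cite: Mochizuki2012, IUTchIV Prop. 1.1 p. 9] [cite: NeukirchANT1999, Ch. II (5.5)] -/
theorem exists_tameRadical_isometry_stable (p : ℕ) [Fact p.Prime] {e : ℕ} (hep : e ∣ p - 1) :
    ∃ (E : IntermediateField ℚ_[p] (PadicAlgCl p)) (_ : FiniteDimensional ℚ_[p] E),
      Module.finrank ℚ_[p] E = e ∧
        ∀ (f : ∀ _ : Fin 2, (E : Type) ≃ₗ[ℚ_[p]] E), (∀ i x, ‖f i x‖ = ‖x‖) →
          (∀ i (r : ℝ), f i '' closedBall (0 : E) r = closedBall 0 r) ∧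
            (PiTensorProduct.congr f :
                PacketAlgebra p (fun _ : Fin 2 => (E : Type)) ≃ₗ[ℚ_[p]] PacketAlgebra p (fun _ : Fin 2 => (E : Type))) ''
                (normalizedPacket p (fun _ : Fin 2 => (E : Type)) :
                  Set (PacketAlgebra p (fun _ : Fin 2 => (E : Type)))) =
              (normalizedPacket p (fun _ : Fin 2 => (E : Type)) : Set (PacketAlgebra p (fun _ : Fin 2 => (E : Type)))) := by
  obtain ⟨E, π, hfd, hK, hπ⟩ := TameRadical.exists_subfield p (TameRadical.pos_of_dvd_sub_one (p := p) hep)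
  exact ⟨E, hfd, hK, fun f hf => ⟨fun i r => image_closedBall_eq_of_norm_map_eq p (f i) (hf i) r,
    TameRadical.congr_image_normalizedPacket_eq_of_isometry (K := E) hep hK hπ f hf⟩⟩

end Literature.IUT.LogVolume

end
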